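import Summits.Ventures.YMGap.SlabAreaLawSU3
import HarnessLib

/-!
# Venture YMGap, track (a) / A4, part 6 — the slab door fed by Bakry–Émery's Poincaré constant and a ONE-LINK VARIANCE
# bound: `SU(3)`, `d = 4`, Wilson AREA LAW for all `0 ≤ β_W ≤ 11/20` conditional on ONE finite-dimensional inequality

HONEST FRAMING: venture file of the cell `pub-ymgap` (QuantumFields programme), seat ENGINE 2 (generation g2).  Kernel
ARITHMETIC over three tree theorems, nothing else:
* p1's slab door `Summit.Ventures.YMGap.Slab.hasAreaLaw_of_oneLinkKRModulus` (`SlabAreaLaw`): a one-link Kantorovich–Rubinstein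
  modulus `OneLinkKRModulus N R K` on the ball `R ≥ 2(d−1)β` ('t Hooft `β`) with slab Dobrushin constant `2(d−1)βK < 1` gives
  Wilson's AREA LAW `HasAreaLaw d (fundamentalRep (Fin N)) (Nβ)` MODULO the printed Durhuus–Fröhlich/Cao–Nissim–Sheffield criterion,
  the tree's named fact `durhuusFrohlich_areaLaw_of_slabClustering d N` (an explicit hypothesis `h` of every area-law theorem here);
* pub-balaban's variance modulus `oneLinkKRModulus_of_varianceBound` (leaf (38) `StrongCouplingVarianceDoorSUN`): the HYPOTHESIS
  SCHEMA `OneLinkVarianceBound N R v` (variance of the linear observable `g ↦ N Re tr(gΔ)` under the tilted one-link law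
  `ν_B ∝ exp(N Re tr(gB)) Haar` at most `v‖Δ‖_F²` on `‖B‖_op ≤ R`), combined with the in-tree Bakry–Émery Poincaré inequality
  `haarPoincare_SU` (constant `1/(N(1/2 − R))`, Shen–Zhu–Zhu Lemma 4.1), gives `OneLinkKRModulus N R √(v/(N(1/2 − R)))` for `R < 1/2`;
* the squared-door lemma `mul_sqrt_lt_one`.
WHAT IS PROVED (class K, conditional on the displayed hypotheses and the named fact):
* `hasAreaLaw_of_varianceBound` (all `d ≥ 2`, `N ≥ 2`): `OneLinkVarianceBound N R v`, `2(d−1)β ≤ R < 1/2` and the slab door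
  `(2(d−1)β)²·v < N(1/2 − R)` ⟹ `HasAreaLaw d (fundamentalRep (Fin N)) (Nβ)` modulo the DF/CNS fact.  With Bakry–Émery's own value
  `v = N/(1/2 − R)` (`oneLinkVarianceBound_bakryEmery`) the door is `R < 1/4`, i.e. exactly the printed CNS threshold `β < 1/(8(d−1))`
  (`hasAreaLaw_of_varianceBound_bakryEmery`, consistency; nothing new);
* `su3_hasAreaLaw_of_varianceBound` (`SU(3)`, `d = 4`, Wilson `β_W = 9β`, tree coupling `β_W/3`, slab radius `2β_W/3`): door
  `(2β_W/3)²·v < 3(1/2 − R)`;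
* `su3_hasAreaLaw_le_elevenTwentieths_of_varianceBound`: IF `OneLinkVarianceBound 3 (11/30) (49/20)` THEN, modulo the DF/CNS fact,
  `HasAreaLaw 4 (fundamentalRep (Fin 3)) (β_W/3)` for EVERY `0 ≤ β_W ≤ 11/20` — door `(11/30)²·(49/20) = 5929/18000 < 3·(4/30) = 2/5`,
  i.e. door product `(11/30)·√((5/2)(49/20)) = 0.9075… < 1` with Bakry–Émery's Poincaré constant `5/2`.  This is the cell's booked
  `11/20` rung (`Slab.su3_hasAreaLaw_le_elevenTwentieths`, PLAN R61/R80) WITHOUT its Poincaré hypothesis `OneLinkPoincareSUN 3 (11/30)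
  (53/100)`: of the two displayed one-link hypotheses only the VARIANCE one remains, and that one is a finite-dimensional inequality
  (`sup_{‖B‖_op ≤ 11/30} λ_max Hess log Z(B) ≤ 49/20`, `Z(B) = ∫_{SU(3)} e^{3 Re tr(gB)} dg`) which the pub-balaban cell reports CERTIFIED
  in ball arithmetic by two independent engines (grade C-iv; `run/shared/lean/pub/pub-balaban/ir/data/FRONT-SC-SU3-sigma1-iv-certificate-g17.json`:
  rigorous sup bounds `2.44999…` / `2.4500`, approximate maximiser value `2.298`) — a COMPUTATION OUTSIDE THE KERNEL, NOT a tree theorem,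
  so the hypothesis stays displayed;
* `su3_hasAreaLaw_le_nineTwentieths_of_varianceBound` (rung `9/20` from `OneLinkVarianceBound 3 (3/10) (47/20)`, the other instance of
  the same certificate) and `su3_hasAreaLaw_le_nineSixteenths_of_varianceBound` (rung `9/16` from `OneLinkVarianceBound 3 (3/8) (5/2)`,
  NOT certified anywhere — displayed as the next target; numerics suggest `≈ 2.32`, NOT evidence);
* `slabVarianceDoor_numbers`: the door arithmetic, and the ceiling of this route: the variance-only slab door needs
  `R²·v(R) < 3(1/2 − R)`, impossible once `v ≥ 3/2` (the Haar floor) and `R ≥ (√41 − 3)/8 = 0.425…` (`β_W ≥ 0.638…`); with the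
  numerically observed `v ≈ 2.3` it shuts near `β_W ≈ 0.57`.
Printed comparison: CNS25 Thm. 1.6 gives the `SU(3)` area law for 't Hooft `β < 1/24`, i.e. `β_W < 3/8`; here `β_W ≤ 11/20` (`× 22/15`)
conditional on the one certified inequality.  For `SU(2)` this route gives NOTHING beyond the cell's `β_W < 2/3`
(`QuarterModulusTwoThirds`): there the one-link modulus at `B = 0` equals `1` exactly, the slab door's own ceiling.
CLASS: K-conditional (named DF/CNS fact + ONE displayed finite-dimensional hypothesis, certified outside the kernel at grade C by
another cell).  Strong-coupling LATTICE statements only; no continuum limit, no mass-gap or Clay claim.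
-/

noncomputable section

open MeasureTheory ProbabilityTheory
open Literature.MathematicalPhysics.QuantumLattice
open Literature.MathematicalPhysics.QuantumFieldTheory
open Literature.MathematicalPhysics.QuantumFieldTheory.Balaban1983to89.StrongCouplingDobrushinWindow
open Summit.QuantumFields.BalabanUV.InfraRed.StrongCouplingVarianceDoorSUN
  (OneLinkVarianceBound oneLinkVarianceBound_bakryEmery oneLinkKRModulus_of_varianceBound mul_sqrt_lt_one)
open Summit.Ventures.YMGap.Slab (hasAreaLaw_of_oneLinkKRModulus)

namespace Summit.Ventures.YMGap.SlabAreaLawVariance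

/-! ## 1. The slab door with the variance modulus, all `d ≥ 2`, `N ≥ 2` -/

/-- **The slab door fed by a one-link variance bound** ('t Hooft units, all `d ≥ 2`, `N ≥ 2`): IF `OneLinkVarianceBound N R v`
holds on a ball `2(d−1)β ≤ R < 1/2` (HYPOTHESIS SCHEMA, displayed) THEN — the Bakry–Émery Poincaré constant `1/(N(1/2 − R))` of the
tilted one-link law turning it into the Kantorovich–Rubinstein modulus `√(v/(N(1/2 − R)))` (`oneLinkKRModulus_of_varianceBound`) —
the slab Dobrushin condition `2(d−1)β·√(v/(N(1/2 − R))) < 1`, written `(2(d−1)β)²·(v/(N(1/2 − R))) < 1`, gives Wilson's AREA LAW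
`HasAreaLaw d (fundamentalRep (Fin N)) (Nβ)` modulo the printed Durhuus–Fröhlich/CNS criterion (named fact `h`).
[cite: CaoNissimSheffield2025dynamical, Theorem 2.3] [cite: arXiv220412737, Lemma 4.1 with (4.4)-(4.6)] -/
theorem hasAreaLaw_of_varianceBound {d N : ℕ} (h : durhuusFrohlich_areaLaw_of_slabClustering d N) (hd : 2 ≤ d)
    (hN : 2 ≤ N) {β R v : ℝ} (hβ : 0 ≤ β) (hv0 : 0 ≤ v) (hR : β * (2 * ((d : ℝ) - 1)) ≤ R) (hR2 : R < 1 / 2)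
    (hv : OneLinkVarianceBound N R v) (hdoor : (2 * ((d : ℝ) - 1) * β) ^ 2 * (v / ((N : ℝ) * (1 / 2 - R))) < 1) :
    HasAreaLaw d (fundamentalRep (Fin N)) ((N : ℝ) * β) := by
  have hd1 : (0 : ℝ) ≤ (d : ℝ) - 1 := by
    have : (2 : ℝ) ≤ d := by exact_mod_cast hd
    linarith
  have hmod := oneLinkKRModulus_of_varianceBound hN hR2 hv0 hv
  refine hasAreaLaw_of_oneLinkKRModulus h hd hN hβ (Real.sqrt_nonneg _) hR hmod ?_
  exact mul_sqrt_lt_one (by positivity) hdoor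

/-- The same door in polynomial form: `(2(d−1)β)²·v < N(1/2 − R)`. [cite: CaoNissimSheffield2025dynamical, Theorem 2.3] -/
theorem hasAreaLaw_of_varianceBound' {d N : ℕ} (h : durhuusFrohlich_areaLaw_of_slabClustering d N) (hd : 2 ≤ d)
    (hN : 2 ≤ N) {β R v : ℝ} (hβ : 0 ≤ β) (hv0 : 0 ≤ v) (hR : β * (2 * ((d : ℝ) - 1)) ≤ R) (hR2 : R < 1 / 2)
    (hv : OneLinkVarianceBound N R v) (hdoor : (2 * ((d : ℝ) - 1) * β) ^ 2 * v < (N : ℝ) * (1 / 2 - R)) :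
    HasAreaLaw d (fundamentalRep (Fin N)) ((N : ℝ) * β) := by
  have hN0 : (0 : ℝ) < N := by exact_mod_cast (show 0 < N by omega)
  have hD : 0 < (N : ℝ) * (1 / 2 - R) := mul_pos hN0 (by linarith)
  refine hasAreaLaw_of_varianceBound h hd hN hβ hv0 hR hR2 hv ?_
  rwa [← mul_div_assoc, div_lt_one hD]

/-- **Consistency (nothing new): Bakry–Émery's own variance constant reproduces the printed CNS threshold.**  With
`v = N/(1/2 − R)` (`oneLinkVarianceBound_bakryEmery`) on `R = 2(d−1)β` the door `(2(d−1)β)²·v < N(1/2 − R)` reads `R² < (1/2 − R)²`,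
i.e. `R < 1/4`, i.e. 't Hooft `β < 1/(8(d−1))` — CNS25 Thm. 1.6 (`Slab.hasAreaLaw_of_lt_cnsThreshold` by another road).
[cite: CaoNissimSheffield2025dynamical, Theorems 1.6 and 2.3] [cite: arXiv220412737, Lemma 4.1] -/
theorem hasAreaLaw_of_varianceBound_bakryEmery {d N : ℕ} (h : durhuusFrohlich_areaLaw_of_slabClustering d N) (hd : 2 ≤ d)
    (hN : 2 ≤ N) {β : ℝ} (hβ : 0 ≤ β) (hlt : β < 1 / (8 * ((d : ℝ) - 1))) :
    HasAreaLaw d (fundamentalRep (Fin N)) ((N : ℝ) * β) := by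
  have hd1 : (0 : ℝ) < (d : ℝ) - 1 := by
    have : (2 : ℝ) ≤ d := by exact_mod_cast hd
    linarith
  have hN0 : (0 : ℝ) < N := by exact_mod_cast (show 0 < N by omega)
  set R : ℝ := β * (2 * ((d : ℝ) - 1)) with hRdef
  have hR0 : 0 ≤ R := by positivity
  have hR4 : R < 1 / 4 := by
    have h8 : 0 < 8 * ((d : ℝ) - 1) := by positivity
    have := (lt_div_iff₀ h8).1 hlt
    rw [hRdef]; linarith
  have hR2 : R < 1 / 2 := by linarith
  have hv := oneLinkVarianceBound_bakryEmery hN hR2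
  refine hasAreaLaw_of_varianceBound' h hd hN hβ (div_nonneg hN0.le (by linarith)) le_rfl hR2 hv ?_
  -- door: R² · N/(1/2 − R) < N (1/2 − R)  ⟸  R² < (1/2 − R)²
  have e : 2 * ((d : ℝ) - 1) * β = R := by rw [hRdef]; ring
  rw [e]
  have h12 : 0 < 1 / 2 - R := by linarith
  have hsq : R ^ 2 < (1 / 2 - R) ^ 2 := by nlinarith
  have : R ^ 2 * ((N : ℝ) / (1 / 2 - R)) = R ^ 2 / (1 / 2 - R) ^ 2 * ((N : ℝ) * (1 / 2 - R)) := by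
    field_simp
  rw [this]
  have hlt1 : R ^ 2 / (1 / 2 - R) ^ 2 < 1 := (div_lt_one (by positivity)).2 hsq
  calc R ^ 2 / (1 / 2 - R) ^ 2 * ((N : ℝ) * (1 / 2 - R))
      < 1 * ((N : ℝ) * (1 / 2 - R)) := mul_lt_mul_of_pos_right hlt1 (by positivity)
    _ = (N : ℝ) * (1 / 2 - R) := one_mul _

/-! ## 2. `SU(3)`, `d = 4`, Wilson units `β_W = 6/g²` -/

/-- **`SU(3)`, `d = 4`, Wilson units — the slab door fed by a variance bound** ('t Hooft `β = β_W/9`, tree coupling `β_W/3`,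
slab radius `6β = 2β_W/3`): IF `OneLinkVarianceBound 3 R v` (displayed, nothing asserted) with `2β_W/3 ≤ R < 1/2` and the door
`(2β_W/3)²·v < 3(1/2 − R)` THEN, modulo the printed DF/CNS criterion, `HasAreaLaw 4 (fundamentalRep (Fin 3)) (β_W/3)`.  The
Poincaré side is Bakry–Émery's in-tree constant `1/(3(1/2 − R))`; no Poincaré hypothesis is displayed.
[cite: CaoNissimSheffield2025dynamical, Theorem 2.3] [cite: arXiv220412737, Lemma 4.1 with (4.4)-(4.6)] -/
theorem su3_hasAreaLaw_of_varianceBound (h : durhuusFrohlich_areaLaw_of_slabClustering 4 3) {βW R v : ℝ} (hβ : 0 ≤ βW)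
    (hv0 : 0 ≤ v) (hR : 2 * βW / 3 ≤ R) (hR2 : R < 1 / 2) (hv : OneLinkVarianceBound 3 R v)
    (hdoor : (2 * βW / 3) ^ 2 * v < 3 * (1 / 2 - R)) : HasAreaLaw 4 (fundamentalRep (Fin 3)) (βW / 3) := by
  have h3 : ((3 : ℕ) : ℝ) * (βW / 9) = βW / 3 := by push_cast; ring
  rw [← h3]
  refine hasAreaLaw_of_varianceBound' h (by norm_num) (by norm_num) (β := βW / 9) (R := R) (v := v) (by positivity) hv0
    (by push_cast; linarith) hR2 hv ?_
  have e : 2 * (((4 : ℕ) : ℝ) - 1) * (βW / 9) = 2 * βW / 3 := by push_cast; ring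
  rw [e]
  push_cast
  exact hdoor

/-- **`SU(3)` AREA LAW FOR ALL `0 ≤ β_W ≤ 11/20`, `d = 4` — CONDITIONAL on ONE finite-dimensional inequality.**  IF
`OneLinkVarianceBound 3 (11/30) (49/20)` — i.e. `Var_{ν_B}(3 Re tr(gΔ)) ≤ (49/20)‖Δ‖_F²` for all `‖B‖_op ≤ 11/30` and all `Δ`,
equivalently `sup_{‖B‖_op ≤ 11/30} λ_max Hess log Z(B) ≤ 49/20` for `Z(B) = ∫_{SU(3)} e^{3 Re tr(gB)} dg`; DISPLAYED, not a tree theorem;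
reported CERTIFIED in ball arithmetic by two independent engines at grade C-iv by the pub-balaban cell
(`FRONT-SC-SU3-sigma1-iv-certificate-g17.json`, rigorous sup bounds `2.44999…`, `2.4500`; Bakry–Émery gives only `45/2`) — THEN,
modulo the printed Durhuus–Fröhlich/CNS criterion (named fact `h`), Wilson's AREA LAW `HasAreaLaw 4 (fundamentalRep (Fin 3)) (β_W/3)`
holds for EVERY `0 ≤ β_W ≤ 11/20`.  Door: `(2β_W/3)² ≤ (11/30)²` and `(11/30)²·(49/20) = 5929/18000 < 2/5 = 3(1/2 − 11/30)`, i.e.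
door product `(11/30)·√((5/2)·(49/20)) = 0.9075… < 1` with Bakry–Émery's Poincaré constant `5/2`.  Compared with the tree's
`Slab.su3_hasAreaLaw_le_elevenTwentieths` the Poincaré hypothesis `OneLinkPoincareSUN 3 (11/30) (53/100)` is no longer needed
(and by `StrongCouplingPoincareDoorSU3Sharp.varianceBound_third_of_elevenThirtieths` the same hypothesis feeds leaf (40)'s `1/2` pair).
Printed comparison: CNS25 Thm. 1.6 gives `β_W < 3/8`. [cite: CaoNissimSheffield2025dynamical, Theorems 1.6 and 2.3] -/
theorem su3_hasAreaLaw_le_elevenTwentieths_of_varianceBound (h : durhuusFrohlich_areaLaw_of_slabClustering 4 3)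
    (hv : OneLinkVarianceBound 3 (11 / 30) (49 / 20)) {βW : ℝ} (hβ : 0 ≤ βW) (hle : βW ≤ 11 / 20) :
    HasAreaLaw 4 (fundamentalRep (Fin 3)) (βW / 3) := by
  refine su3_hasAreaLaw_of_varianceBound h hβ (by norm_num) (by linarith) (by norm_num) hv ?_
  have h0 : 0 ≤ 2 * βW / 3 := by positivity
  have h1 : 2 * βW / 3 ≤ 11 / 30 := by linarith
  have hsq : (2 * βW / 3) ^ 2 ≤ (11 / 30) ^ 2 := pow_le_pow_left₀ h0 h1 2
  exact lt_of_le_of_lt (mul_le_mul_of_nonneg_right hsq (by norm_num)) (by norm_num)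

/-- The `11/20` rung at its end-point. [cite: CaoNissimSheffield2025dynamical, Theorem 2.3] -/
theorem su3_hasAreaLaw_elevenTwentieths_of_varianceBound (h : durhuusFrohlich_areaLaw_of_slabClustering 4 3)
    (hv : OneLinkVarianceBound 3 (11 / 30) (49 / 20)) :
    HasAreaLaw 4 (fundamentalRep (Fin 3)) ((11 / 20 : ℝ) / 3) :=
  su3_hasAreaLaw_le_elevenTwentieths_of_varianceBound h hv (by norm_num) le_rfl

/-- **`SU(3)` AREA LAW FOR ALL `0 ≤ β_W ≤ 9/20` — CONDITIONAL** on `OneLinkVarianceBound 3 (3/10) (47/20)` (displayed; the other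
instance reported certified at grade C-iv by the same two-engine certificate, sup bounds `2.34999…`, `2.35000`): door
`(3/10)²·(47/20) = 423/2000 < 3/5 = 3(1/2 − 3/10)`.  Implied by the `11/20` rung's hypothesis through `OneLinkVarianceBound.mono`
only up to the constant (`47/20 < 49/20`), hence recorded separately. [cite: CaoNissimSheffield2025dynamical, Theorem 2.3] -/
theorem su3_hasAreaLaw_le_nineTwentieths_of_varianceBound (h : durhuusFrohlich_areaLaw_of_slabClustering 4 3)
    (hv : OneLinkVarianceBound 3 (3 / 10) (47 / 20)) {βW : ℝ} (hβ : 0 ≤ βW) (hle : βW ≤ 9 / 20) :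
    HasAreaLaw 4 (fundamentalRep (Fin 3)) (βW / 3) := by
  refine su3_hasAreaLaw_of_varianceBound h hβ (by norm_num) (by linarith) (by norm_num) hv ?_
  have h0 : 0 ≤ 2 * βW / 3 := by positivity
  have h1 : 2 * βW / 3 ≤ 3 / 10 := by linarith
  have hsq : (2 * βW / 3) ^ 2 ≤ (3 / 10) ^ 2 := pow_le_pow_left₀ h0 h1 2
  exact lt_of_le_of_lt (mul_le_mul_of_nonneg_right hsq (by norm_num)) (by norm_num)

/-- **`SU(3)` AREA LAW FOR ALL `0 ≤ β_W ≤ 9/16` — CONDITIONAL on the NEXT target** `OneLinkVarianceBound 3 (3/8) (5/2)` (NOT certified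
anywhere; displayed as the target a ball-arithmetic certificate on the larger ball `‖B‖_op ≤ 3/8` would have to meet; numerics of the
pub-balaban lineage suggest `sup λ_max Hess log Z ≈ 2.3` there — NUMERICS, NOT EVIDENCE): door `(3/8)²·(5/2) = 45/128 < 3/8 = 3(1/2 − 3/8)`.
[cite: CaoNissimSheffield2025dynamical, Theorem 2.3] -/
theorem su3_hasAreaLaw_le_nineSixteenths_of_varianceBound (h : durhuusFrohlich_areaLaw_of_slabClustering 4 3)
    (hv : OneLinkVarianceBound 3 (3 / 8) (5 / 2)) {βW : ℝ} (hβ : 0 ≤ βW) (hle : βW ≤ 9 / 16) :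
    HasAreaLaw 4 (fundamentalRep (Fin 3)) (βW / 3) := by
  refine su3_hasAreaLaw_of_varianceBound h hβ (by norm_num) (by linarith) (by norm_num) hv ?_
  have h0 : 0 ≤ 2 * βW / 3 := by positivity
  have h1 : 2 * βW / 3 ≤ 3 / 8 := by linarith
  have hsq : (2 * βW / 3) ^ 2 ≤ (3 / 8) ^ 2 := pow_le_pow_left₀ h0 h1 2
  exact lt_of_le_of_lt (mul_le_mul_of_nonneg_right hsq (by norm_num)) (by norm_num)

/-! ## 3. Numbers of this leaf (door arithmetic and the ceiling of the route; orientation only) -/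

/-- Numbers: (i) the three doors used above (`11/20`, `9/20`, `9/16`); (ii) the door products squared with Bakry–Émery's Poincaré
constants `5/2` (`R = 11/30`), `5/3` (`R = 3/10`), `8/3` (`R = 3/8`): `0.8235…`, `0.3525`, `0.9375`; (iii) Bakry–Émery's own variance
constants `45/2`, `15`, `24` at these radii shut the same doors (the hypothesis-free rung stays `β_W < 3/8`); (iv) the CEILING of the
variance-only slab door: since every admissible `v` is at least the Haar value `3/2`, the door `R²·v < 3(1/2 − R)` forces
`R² < 2(1/2 − R)`, i.e. `R < (√41 − 3)/8`; at `R = 17/40 = 0.425` (`β_W = 51/80 = 0.6375`) it is already shut with `v = 3/2`: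
`(17/40)²·(3/2) ≥ 3(1/2 − 17/40)`. [folklore] -/
theorem slabVarianceDoor_numbers :
    (11 / 30 : ℝ) ^ 2 * (49 / 20) < 3 * (1 / 2 - 11 / 30) ∧ (3 / 10 : ℝ) ^ 2 * (47 / 20) < 3 * (1 / 2 - 3 / 10) ∧
      (3 / 8 : ℝ) ^ 2 * (5 / 2) < 3 * (1 / 2 - 3 / 8) ∧
      (11 / 30 : ℝ) ^ 2 * ((5 / 2) * (49 / 20)) = 5929 / 7200 ∧ (3 / 10 : ℝ) ^ 2 * ((5 / 3) * (47 / 20)) = 141 / 400 ∧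
      (3 / 8 : ℝ) ^ 2 * ((8 / 3) * (5 / 2)) = 15 / 16 ∧
      (1 : ℝ) / (3 * (1 / 2 - 11 / 30)) = 5 / 2 ∧ (1 : ℝ) / (3 * (1 / 2 - 3 / 10)) = 5 / 3 ∧ (1 : ℝ) / (3 * (1 / 2 - 3 / 8)) = 8 / 3 ∧
      ¬ (11 / 30 : ℝ) ^ 2 * (3 / (1 / 2 - 11 / 30)) < 3 * (1 / 2 - 11 / 30) ∧
      ¬ (3 / 10 : ℝ) ^ 2 * (3 / (1 / 2 - 3 / 10)) < 3 * (1 / 2 - 3 / 10) ∧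
      ¬ (17 / 40 : ℝ) ^ 2 * (3 / 2) < 3 * (1 / 2 - 17 / 40) ∧
      (3 : ℝ) / 8 < 9 / 20 ∧ (9 : ℝ) / 20 < 1 / 2 ∧ (1 : ℝ) / 2 < 11 / 20 ∧ (11 : ℝ) / 20 < 9 / 16 ∧ (9 : ℝ) / 16 < 51 / 80 := by
  norm_num

end Summit.Ventures.YMGap.SlabAreaLawVariance
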